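import Mathlib.RingTheory.Flat.Basic
import Mathlib.RingTheory.Flat.Equalizer
import Mathlib.RingTheory.Flat.Tensor
import Mathlib.LinearAlgebra.TensorProduct.RightExactness
import Mathlib.Algebra.Module.Projective
import HarnessLib

/-!
# Vanishing of `Tor₁` without `Tor`: the presentation-free injectivity toolkit

Mathlib (pin v4.32) characterises flatness of an `R`-module `N` by the injectivity of
`N ⊗ I → N ⊗ R` for ideals `I` (`Module.Flat.iff_lTensor_injective'`) and proves that `N ⊗ −`
preserves short exact sequences ending in a *flat* module
(`LinearMap.lTensor_injective_of_exact_of_flat`), but it has no usable `Tor` functors for modules.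
The local and nilpotent flatness criteria (Matsumura, *Commutative Ring Theory*, Thm. 22.3) are
stated with `Tor₁^R(Q, N) = 0`; this file provides the elementary substitute:

* `TorOneVanishes R N Q` — for the canonical free presentation `0 → K → (Q →₀ R) → Q → 0`, the map
  `N ⊗ K → N ⊗ (Q →₀ R)` is injective (i.e. `Tor₁^R(Q, N) = 0`).
* `lTensor_injective_of_presentation` — **independence of the presentation**: if for ONE
  presentation `0 → K → P → Q → 0` with `P` projective `N ⊗ K → N ⊗ P` is injective, then
  `N ⊗ Q₁ → N ⊗ Q₂` is injective for EVERY short exact sequence `0 → Q₁ → Q₂ → Q → 0`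
  (the usual `Tor₁(Q, N) → N ⊗ Q₁ → N ⊗ Q₂` argument, done by an explicit fibre-product chase).
* `TorOneVanishes.lTensor_injective`, `.of_presentation`, `.of_flat`, `.of_linearEquiv`,
  `.of_subsingleton`, and **`TorOneVanishes.extension`**: the class of `Q` with
  `Tor₁(Q, N) = 0` is closed under extensions (Matsumura, Thm. 22.3, proof of (3′) ⇒ (2) and of
  (4) ⇒ (5): "`0 → IN → N → N/IN → 0` is exact, so that by induction ...").

Intended input of the nilpotent case of Thm. 22.3 and of the local criterion Ex. 22.3
(files `NilpotentCriterion.lean`, `LocalCriterion.lean` of this directory, to follow).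

## References

* H. Matsumura, *Commutative Ring Theory*, CSAM 8 (1986), §22, Thm. 22.3 and its proof
  (book pp. 174–176). [Matsumura1987]
* The Stacks Project, Tag 00HL (Algebra, Lemma 10.39.12). [StacksProject]
-/

universe u v w w₁ w₂ w₃

open TensorProduct

namespace Literature.RingTheory.Flat

variable {R : Type u} [CommRing R] {N : Type v} [AddCommGroup N] [Module R N]

variable (R N) in
/-- **`Tor₁^R(Q, N) = 0`, elementarily.** For the canonical free presentation
`0 → K → (Q →₀ R) —Σ→ Q → 0` (`Σ = Finsupp.linearCombination R id`, `K = Ker Σ`), the map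
`N ⊗ K → N ⊗ (Q →₀ R)` is injective. By `lTensor_injective_of_presentation` this does not depend
on the presentation. [cite: Matsumura1987, §22 Thm. 22.3 (3′)] -/
def TorOneVanishes (Q : Type w) [AddCommGroup Q] [Module R Q] : Prop :=
  Function.Injective
    ((LinearMap.ker (Finsupp.linearCombination R (id : Q → Q))).subtype.lTensor N)

section Core

variable {K : Type w₁} {P : Type w₂} {Q : Type w} [AddCommGroup K] [Module R K]
  [AddCommGroup P] [Module R P] [AddCommGroup Q] [Module R Q]
  {Q₁ : Type w₃} {Q₂ : Type*} [AddCommGroup Q₁] [Module R Q₁] [AddCommGroup Q₂] [Module R Q₂]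

/-- **Independence of the presentation** (the map `Tor₁(Q, N) → N ⊗ Q₁ → N ⊗ Q₂`, by hand).
Let `K —i→ P —π→ Q → 0` be exact with `P` projective and `N ⊗ K → N ⊗ P` injective, and let
`0 → Q₁ —f→ Q₂ —g→ Q → 0` be exact. Then `N ⊗ Q₁ → N ⊗ Q₂` is injective.
Proof: lift `π` to `σ : P → Q₂` (`g ∘ σ = π`) and `σ ∘ i` to `τ : K → Q₁` (`f ∘ τ = σ ∘ i`); then
`0 → K —(−τ, i)→ Q₁ × P —(f, σ)→ Q₂ → 0` is exact and `f = (f, σ) ∘ inl`; tensoring, an element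
of `Ker(N ⊗ f)` comes from `N ⊗ K` and its `N ⊗ P`-component vanishes, so it is `0`.
[cite: Matsumura1987, §22 Thm. 22.3, proof of (3′) ⇒ (2)] -/
theorem lTensor_injective_of_presentation [Module.Projective R P] (i : K →ₗ[R] P)
    (π : P →ₗ[R] Q) (hiπ : Function.Exact i π) (hπ : Function.Surjective π)
    (hinj : Function.Injective (i.lTensor N)) {f : Q₁ →ₗ[R] Q₂} {g : Q₂ →ₗ[R] Q}
    (hfg : Function.Exact f g) (hf : Function.Injective f) (hg : Function.Surjective g) :
    Function.Injective (f.lTensor N) := by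
  -- lift `π` through `g`
  obtain ⟨σ, hσ⟩ := Module.projective_lifting_property g π hg
  have hσ' : ∀ p, g (σ p) = π p := fun p => congrArg (fun h : P →ₗ[R] Q => h p) hσ
  -- `σ ∘ i` lands in `range f = ker g`
  have hmem : ∀ k : K, σ (i k) ∈ LinearMap.range f := fun k => by
    rw [← hfg.linearMap_ker_eq, LinearMap.mem_ker, hσ', hiπ.apply_apply_eq_zero]
  let τ : K →ₗ[R] Q₁ :=
    (LinearEquiv.ofInjective f hf).symm.toLinearMap ∘ₗ ((σ ∘ₗ i).codRestrict _ hmem)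
  have hτ : ∀ k, f (τ k) = σ (i k) := fun k => by
    simp [τ, LinearEquiv.ofInjective_symm_apply]
  -- the short exact sequence `0 → K → Q₁ × P → Q₂ → 0`
  let Φ : Q₁ × P →ₗ[R] Q₂ := f.coprod σ
  let ψ : K →ₗ[R] Q₁ × P := (-τ).prod i
  have hψΦ : Function.Exact ψ Φ := by
    intro qp
    constructor
    · intro h0
      obtain ⟨q, p⟩ := qp
      have h0' : f q + σ p = 0 := by simpa [Φ] using h0
      have hp : π p = 0 := by
        rw [← hσ', show σ p = -f q from eq_neg_of_add_eq_zero_right h0', map_neg,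
          hfg.apply_apply_eq_zero, neg_zero]
      obtain ⟨k, rfl⟩ := (hiπ p).mp hp
      refine ⟨k, ?_⟩
      have hq : f q = f (-τ k) := by
        rw [map_neg, hτ]; exact eq_neg_of_add_eq_zero_left h0'
      have hq' : q = -τ k := hf hq
      simp [ψ, hq']
    · rintro ⟨k, rfl⟩
      simp [ψ, Φ, hτ]
  have hΦ : Function.Surjective Φ := by
    intro q₂
    obtain ⟨p, hp⟩ := hπ (g q₂)
    have : g (q₂ - σ p) = 0 := by rw [map_sub, hσ', hp, sub_self]
    obtain ⟨q₁, hq₁⟩ := (hfg _).mp this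
    exact ⟨(q₁, p), by simp [Φ, hq₁]⟩
  have hex := lTensor_exact N hψΦ hΦ
  -- the chase
  rw [← LinearMap.ker_eq_bot, Submodule.eq_bot_iff]
  intro u hu
  rw [LinearMap.mem_ker] at hu
  have h1 : (Φ.lTensor N) ((LinearMap.inl R Q₁ P).lTensor N u) = 0 := by
    rw [← LinearMap.comp_apply, ← LinearMap.lTensor_comp]
    simpa [Φ] using hu
  obtain ⟨w, hw⟩ := (hex _).mp h1
  have h2 : (i.lTensor N) w = 0 := by
    have := congrArg ((LinearMap.snd R Q₁ P).lTensor N) hw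
    rw [← LinearMap.comp_apply, ← LinearMap.lTensor_comp, ← LinearMap.comp_apply,
      ← LinearMap.lTensor_comp] at this
    simpa [ψ] using this
  have hw0 : w = 0 := hinj (by rw [h2, map_zero])
  have h3 : (LinearMap.inl R Q₁ P).lTensor N u = 0 := by rw [← hw, hw0, map_zero]
  have := congrArg ((LinearMap.fst R Q₁ P).lTensor N) h3
  rw [← LinearMap.comp_apply, ← LinearMap.lTensor_comp] at this
  simpa using this

end Core

namespace TorOneVanishes

variable {Q : Type w} [AddCommGroup Q] [Module R Q]

/-- The canonical presentation `0 → K → (Q →₀ R) → Q → 0` is exact. [folklore] -/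
theorem exact_canonical :
    Function.Exact (LinearMap.ker (Finsupp.linearCombination R (id : Q → Q))).subtype
      (Finsupp.linearCombination R (id : Q → Q)) :=
  LinearMap.exact_subtype_ker_map _

/-- Unfolding `TorOneVanishes` (use this rather than definitional unfolding at call sites).
[folklore] -/
theorem injective (h : TorOneVanishes R N Q) :
    Function.Injective
      ((LinearMap.ker (Finsupp.linearCombination R (id : Q → Q))).subtype.lTensor N) :=
  h

/-- Folding `TorOneVanishes`. [folklore] -/
theorem mk (h : Function.Injective
      ((LinearMap.ker (Finsupp.linearCombination R (id : Q → Q))).subtype.lTensor N)) :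
    TorOneVanishes R N Q :=
  h

/-- If `Tor₁(Q, N) = 0` then `N ⊗ Q₁ → N ⊗ Q₂` is injective for every short exact sequence
`0 → Q₁ → Q₂ → Q → 0`. [cite: Matsumura1987, §22 Thm. 22.3, proof of (3′) ⇒ (2)] -/
theorem lTensor_injective (h : TorOneVanishes R N Q) {Q₁ : Type w₁} {Q₂ : Type w₂}
    [AddCommGroup Q₁] [Module R Q₁] [AddCommGroup Q₂] [Module R Q₂] {f : Q₁ →ₗ[R] Q₂}
    {g : Q₂ →ₗ[R] Q} (hfg : Function.Exact f g) (hf : Function.Injective f)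
    (hg : Function.Surjective g) : Function.Injective (f.lTensor N) :=
  lTensor_injective_of_presentation
    (K := ↥(LinearMap.ker (Finsupp.linearCombination R (id : Q → Q)))) (P := Q →₀ R)
    (LinearMap.ker (Finsupp.linearCombination R (id : Q → Q))).subtype
    (Finsupp.linearCombination R (id : Q → Q)) exact_canonical
    (Finsupp.linearCombination_id_surjective R Q) h.injective hfg hf hg

/-- `Tor₁(Q, N) = 0` may be checked on any presentation `K —i→ P —π→ Q → 0` with `P` projective
(injectivity of `i` is not needed). [cite: Matsumura1987, §22 Thm. 22.3, proof of (3′) ⇒ (2)] -/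
theorem of_presentation {K : Type w₁} {P : Type w₂} [AddCommGroup K] [Module R K]
    [AddCommGroup P] [Module R P] [Module.Projective R P] (i : K →ₗ[R] P) (π : P →ₗ[R] Q)
    (hiπ : Function.Exact i π) (hπ : Function.Surjective π)
    (hinj : Function.Injective (i.lTensor N)) : TorOneVanishes R N Q :=
  mk <| lTensor_injective_of_presentation
    (Q₁ := ↥(LinearMap.ker (Finsupp.linearCombination R (id : Q → Q)))) (Q₂ := Q →₀ R)
    i π hiπ hπ hinj exact_canonical (Submodule.injective_subtype _)
    (Finsupp.linearCombination_id_surjective R Q)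

/-- `Tor₁(Q, N) = 0` for `Q` flat (Stacks 00HL). [cite: StacksProject, Tag 00HL] -/
theorem of_flat [Module.Flat R Q] : TorOneVanishes R N Q :=
  mk <| LinearMap.lTensor_injective_of_exact_of_flat (Finsupp.linearCombination R (id : Q → Q))
    (Finsupp.linearCombination_id_surjective R Q) _ (Submodule.injective_subtype _)
    exact_canonical N

/-- `Tor₁(Q, N) = 0` is invariant under isomorphisms of `Q`. [folklore] -/
theorem of_linearEquiv {Q' : Type w₁} [AddCommGroup Q'] [Module R Q'] (e : Q ≃ₗ[R] Q')
    (h : TorOneVanishes R N Q) : TorOneVanishes R N Q' := by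
  refine of_presentation
    (K := ↥(LinearMap.ker (Finsupp.linearCombination R (id : Q → Q)))) (P := Q →₀ R)
    (LinearMap.ker (Finsupp.linearCombination R (id : Q → Q))).subtype
    (e.toLinearMap ∘ₗ Finsupp.linearCombination R (id : Q → Q)) ?_ ?_ h.injective
  · intro x
    simp only [LinearMap.coe_comp, LinearEquiv.coe_coe, Function.comp_apply,
      EmbeddingLike.map_eq_zero_iff, Submodule.coe_subtype, Set.mem_range, Subtype.exists,
      LinearMap.mem_ker, exists_prop, exists_eq_right]
  · exact e.surjective.comp (Finsupp.linearCombination_id_surjective R Q)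

/-- `Tor₁(0, N) = 0`. [folklore] -/
theorem of_subsingleton [Subsingleton Q] : TorOneVanishes R N Q :=
  haveI : Module.Free R Q := Module.Free.of_subsingleton R Q
  of_flat

/-- The chase behind `extension`, for an arbitrary projective presentation `P —π→ Q`: if
`0 → Q′ —a→ Q —b→ Q″ → 0` is exact and `Tor₁(Q′, N) = Tor₁(Q″, N) = 0` then
`N ⊗ Ker π → N ⊗ P` is injective — with `K = Ker π ⊆ K′ = Ker (b ∘ π)`, the inclusion
`N ⊗ K′ → N ⊗ P` is injective (cokernel `Q″`) and so is `N ⊗ K → N ⊗ K′` (cokernel `K′/K ≅ Q′`).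
[cite: Matsumura1987, §22 Thm. 22.3, proof of (4) ⇒ (5)] -/
theorem lTensor_injective_ker_of_extension {P : Type w₃} [AddCommGroup P] [Module R P]
    (π : P →ₗ[R] Q) (hπ : Function.Surjective π) {Q' : Type w₁} {Q'' : Type w₂}
    [AddCommGroup Q'] [Module R Q'] [AddCommGroup Q''] [Module R Q''] {a : Q' →ₗ[R] Q}
    {b : Q →ₗ[R] Q''} (hab : Function.Exact a b) (ha : Function.Injective a)
    (hb : Function.Surjective b) (h' : TorOneVanishes R N Q') (h'' : TorOneVanishes R N Q'') :
    Function.Injective ((LinearMap.ker π).subtype.lTensor N) := by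
  let K : Submodule R P := LinearMap.ker π
  let K' : Submodule R P := LinearMap.ker (b ∘ₗ π)
  have hKK' : K ≤ K' := fun x hx => by
    have hx' : π x = 0 := hx
    change b (π x) = 0
    rw [hx', map_zero]
  -- `N ⊗ K' → N ⊗ P` is injective: its cokernel is `Q''`
  have h1 : Function.Injective (K'.subtype.lTensor N) :=
    h''.lTensor_injective (LinearMap.exact_subtype_ker_map _) (Submodule.injective_subtype _)
      (hb.comp hπ)
  -- `N ⊗ K → N ⊗ K'` is injective: its cokernel is `Q'`
  have hmem : ∀ k' : K', π (k' : P) ∈ LinearMap.range a := fun k' => by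
    rw [← hab.linearMap_ker_eq, LinearMap.mem_ker]
    exact k'.2
  let ρ : K' →ₗ[R] Q' :=
    (LinearEquiv.ofInjective a ha).symm.toLinearMap ∘ₗ ((π ∘ₗ K'.subtype).codRestrict _ hmem)
  have hρ : ∀ k', a (ρ k') = π (k' : P) := fun k' => by
    simp [ρ, LinearEquiv.ofInjective_symm_apply]
  have hexact : Function.Exact (Submodule.inclusion hKK') ρ := by
    intro k'
    constructor
    · intro h0
      have : π (k' : P) = 0 := by rw [← hρ, h0, map_zero]
      exact ⟨⟨(k' : P), this⟩, rfl⟩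
    · rintro ⟨k, rfl⟩
      apply ha
      rw [hρ, map_zero]
      exact k.2
  have hρsurj : Function.Surjective ρ := by
    intro q'
    obtain ⟨p, hp⟩ := hπ (a q')
    have hp' : p ∈ K' := by
      change b (π p) = 0
      rw [hp, hab.apply_apply_eq_zero]
    refine ⟨⟨p, hp'⟩, ha ?_⟩
    rw [hρ, hp]
  have h2 : Function.Injective ((Submodule.inclusion hKK').lTensor N) :=
    h'.lTensor_injective hexact (Submodule.inclusion_injective hKK') hρsurj
  -- compose
  have hcomp : K.subtype = K'.subtype ∘ₗ Submodule.inclusion hKK' := rfl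
  change Function.Injective (K.subtype.lTensor N)
  rw [hcomp, LinearMap.lTensor_comp]
  exact h1.comp h2

/-- **Extensions.** If `0 → Q′ —a→ Q —b→ Q″ → 0` is exact and `Tor₁(Q′, N) = Tor₁(Q″, N) = 0`
then `Tor₁(Q, N) = 0` (`lTensor_injective_ker_of_extension` for the canonical presentation).
[cite: Matsumura1987, §22 Thm. 22.3, proof of (4) ⇒ (5)] -/
theorem extension {Q' : Type w₁} {Q'' : Type w₂} [AddCommGroup Q'] [Module R Q']
    [AddCommGroup Q''] [Module R Q''] {a : Q' →ₗ[R] Q} {b : Q →ₗ[R] Q''}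
    (hab : Function.Exact a b) (ha : Function.Injective a) (hb : Function.Surjective b)
    (h' : TorOneVanishes R N Q') (h'' : TorOneVanishes R N Q'') : TorOneVanishes R N Q :=
  mk <| lTensor_injective_ker_of_extension (Finsupp.linearCombination R (id : Q → Q))
    (Finsupp.linearCombination_id_surjective R Q) hab ha hb h' h''

end TorOneVanishes

/-- **Flatness from `Tor₁`.** `N` is flat iff `Tor₁^R(R ⧸ I, N) = 0` for every ideal `I`
(Matsumura Thm. 7.7/7.8: flatness is tested on `I ⊗ N → N`). [cite: Matsumura1987, §7 Thm. 7.7] -/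
theorem flat_iff_torOneVanishes_quotient :
    Module.Flat R N ↔ ∀ I : Ideal R, TorOneVanishes R N (R ⧸ I) := by
  constructor
  · intro hN I
    exact TorOneVanishes.of_presentation (K := ↥I) (P := R) I.subtype I.mkQ
      (LinearMap.exact_subtype_mkQ I) (Submodule.mkQ_surjective I)
      (Module.Flat.lTensor_preserves_injective_linearMap _ (Submodule.injective_subtype _))
  · intro h
    rw [Module.Flat.iff_lTensor_injective']
    intro I
    exact (h I).lTensor_injective (Q₁ := ↥I) (Q₂ := R) (f := I.subtype) (g := I.mkQ)
      (LinearMap.exact_subtype_mkQ I) (Submodule.injective_subtype _) (Submodule.mkQ_surjective I)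

/-- If `N` is flat then `Tor₁(Q, N) = 0` for every `Q`. [cite: Matsumura1987, §7 Thm. 7.7] -/
theorem TorOneVanishes.of_flat_left [Module.Flat R N] {Q : Type w} [AddCommGroup Q]
    [Module R Q] : TorOneVanishes R N Q :=
  TorOneVanishes.mk <|
    Module.Flat.lTensor_preserves_injective_linearMap _ (Submodule.injective_subtype _)

end Literature.RingTheory.Flat
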